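import Summits.NavierStokesRegularity.NavierStokesRegularity.Theorems.ClockStretchingLawClockCeilingZoomScaling
import Summits.NavierStokesRegularity.NavierStokesRegularity.Theorems.ClockStretchingLawClockCeilingZoomDerivLimit
import Summits.NavierStokesRegularity.NavierStokesRegularity.Theorems.ClockStretchingLawClockCeilingZoomLimitClass
import Summits.NavierStokesRegularity.NavierStokesRegularity.Theorems.ClockStretchingLawClockCeilingZoomFrame
import Summits.NavierStokesRegularity.NavierStokesRegularity.Theorems.ClockStretchingLawClockCeilingStubUniformBounds
import HarnessLib

/-!
# Route ClockStretchingLaw — crux `ClockCeiling`, line `registered`: stub `stub_zoomCompactness`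

The lead's stub of the reshaped skeleton of crux `ClockCeiling` (item
stmt-NavierStokesRegularity-10570): GIVEN the scale-invariant bounds of `stub_uniformBounds`,
the parabolic zooms `u_k = Λ_k u(Λ_k² ·, Λ_k ·)`, `Λ_k ∈ (0,1]`, of an element `u` of the route's
Type-I class (jointly smooth, divergence free, KNSS-mild, `‖u‖ ≤ C/√(-t)`, local energies
`A, E ≤ C`) subconverge to an element `v` of the same class (same constant `C`) with CONTINUOUS
CONVERGENCE of the frame form at every `t < 0`:
`frame_u(Λ_{φk}² t; c_k, b_k) → frame_v(t; c₀, b)` whenever `(c_k, b_k) → (c₀, b)`.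

Assembly of the four landed helper files:
`…ZoomScaling` (the class and the frame form under the zoom: `zoomClass_nsRescale`,
`frame_zoom`), `…ZoomLimitClass` (KNSS 2009 Lemma 6.1: zoom limits exist and are Type-I ancient
mild fields, `exists_zoomLimit`), `…ZoomDerivLimit` (clock and translation modes converge
pointwise under the uniform second-derivative bounds, `tendsto_timeDeriv_of_typeI`,
`tendsto_fderiv_apply_of_typeI`), `…ZoomLimitEnergy` (local energies pass to the limit,
`localEnergy_of_limit`; operators converge, `tendsto_clm_of_tendsto_apply`) and `…ZoomFrame`
(dominated convergence of the frame integrals, `tendsto_frame_of_limit`).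

## References

* G. Koch, N. Nadirashvili, G. Seregin, V. Šverák, Acta Math. 203 (2009) = arXiv:0709.3599,
  Lemma 6.1 (p. 11), Prop. 4.1 (p. 8).
* D. Albritton, T. Barker, arXiv:1811.00502, §1–2 (the Type-I class with scaled energies).
-/

set_option linter.dupNamespace false

noncomputable section

open Literature.Analysis.FluidPDE MeasureTheory Set Function Filter Topology Metric
open scoped ENNReal NNReal

namespace Summit.NavierStokesRegularity.NavierStokesRegularity.Theorems

/-- **Zoom compactness given the uniform bounds** (the form with the statement of `stub_uniformBounds`
as an explicit hypothesis, used by the composition `stub_frameRigidity_of`). Given the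
uniform scale-invariant bounds of the class (`stub_uniformBounds`), for every element `u` of the
route's Type-I class and every sequence of zoom factors `Λₙ ∈ (0,1]` there are a subsequence `φ`
and an element `v` of the class (same constant) such that the frame form converges continuously:
`frame_u(Λ_{φk}² t; c_k, b_k) → frame_v(t; c₀, b)` whenever `(c_k, b_k) → (c₀, b)`, `t < 0`
(KNSS 2009 Lemma 6.1 for the zooms + Prop. 4.1 uniform bounds + dominated convergence).
[cite: KochNadirashviliSereginSverak2009, Lemma 6.1 and Prop. 4.1 (arXiv:0709.3599 pp. 8, 11)] -/
theorem zoomCompactness_of_uniformBounds :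
    (∃ K : ℝ → ℝ, ∀ (C : ℝ) (u : ℝ → EuclideanSpace ℝ (Fin 3) → EuclideanSpace ℝ (Fin 3)), ContDiffOn ℝ (⊤ : ℕ∞) (Function.uncurry u) (Set.Iio 0 ×ˢ Set.univ) ∧ (∀ t < 0, Literature.Analysis.FluidPDE.VectorCalculus.IsDivFree (u t)) ∧ (∀ s t : ℝ, s < t → t < 0 → ∀ x, u t x = Literature.Analysis.FluidPDE.heatFlow (u s) (t - s) x - ∫ τ in Set.Ioo s t, ∫ y, ((-(inner ℝ (x - y) (u τ y) / (2 * (t - τ)) * Literature.Analysis.UnboundedOperators.heatKernel (t - τ) (x - y))) • u τ y + (∫ σ in Set.Ioi (t - τ), Literature.Analysis.UnboundedOperators.heatKernel σ (x - y) / (4 * σ ^ 2)) • (inner ℝ (x - y) (u τ y) • u τ y + inner ℝ (u τ y) (u τ y) • (x - y) + inner ℝ (x - y) (u τ y) • u τ y) - ((∫ σ in Set.Ioi (t - τ), Literature.Analysis.UnboundedOperators.heatKernel σ (x - y) / (8 * σ ^ 3)) * (inner ℝ (x - y) (u τ y) * inner ℝ (x - y) (u τ y))) • (x - y))) ∧ Literature.Analysis.FluidPDE.HasTypeITimeDecay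 C u ∧ (∀ (x₀ : EuclideanSpace ℝ (Fin 3)) (t₀ r : ℝ), t₀ ≤ 0 → 0 < r → (∀ t, t₀ - r ^ 2 < t → t < t₀ → r⁻¹ * ∫ x in Metric.ball x₀ r, ‖u t x‖ ^ 2 ≤ C) ∧ r⁻¹ * ∫ t in Set.Ioo (t₀ - r ^ 2) t₀, ∫ x in Metric.ball x₀ r, ‖fderiv ℝ (u t) x‖ ^ 2 ≤ C) → ∀ t : ℝ, t < 0 → ∀ x : EuclideanSpace ℝ (Fin 3), ‖Literature.Analysis.FluidPDE.timeDeriv u t x‖ ≤ K C * (-t) ^ (-(3 : ℝ) / 2) ∧ ‖fderiv ℝ (u t) x‖ ≤ K C * (-t) ^ (-(1 : ℝ)) ∧ ‖iteratedFDeriv ℝ 2 (u t) x‖ ≤ K C * (-t) ^ (-(3 : ℝ) / 2) ∧ ‖fderiv ℝ (fun y => Literature.Analysis.FluidPDE.timeDeriv u t y) x‖ ≤ K C * (-t) ^ (-(2 : ℝ)) ∧ ‖iteratedDeriv 2 (fun s => u s x) t‖ ≤ K C * (-t) ^ (-(5 : ℝ) / 2)) → ∀ (C : ℝ) (u : ℝ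 → EuclideanSpace ℝ (Fin 3) → EuclideanSpace ℝ (Fin 3)), ContDiffOn ℝ (⊤ : ℕ∞) (Function.uncurry u) (Set.Iio 0 ×ˢ Set.univ) ∧ (∀ t < 0, Literature.Analysis.FluidPDE.VectorCalculus.IsDivFree (u t)) ∧ (∀ s t : ℝ, s < t → t < 0 → ∀ x, u t x = Literature.Analysis.FluidPDE.heatFlow (u s) (t - s) x - ∫ τ in Set.Ioo s t, ∫ y, ((-(inner ℝ (x - y) (u τ y) / (2 * (t - τ)) * Literature.Analysis.UnboundedOperators.heatKernel (t - τ) (x - y))) • u τ y + (∫ σ in Set.Ioi (t - τ), Literature.Analysis.UnboundedOperators.heatKernel σ (x - y) / (4 * σ ^ 2)) • (inner ℝ (x - y) (u τ y) • u τ y + inner ℝ (u τ y) (u τ y) • (x - y) + inner ℝ (x - y) (u τ y) • u τ y) - ((∫ σ in Set.Ioi (t - τ), Literature.Analysis.UnboundedOperators.heatKernel σ (x - y) / (8 * σ ^ 3)) * (inner ℝ (x - y) (u τ y) * inner ℝ (x - y) (u τ y))) • (x - y))) ∧ Literature.Analysis.FluidPDE.HasTypeITimeDecay C u ∧ (∀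 (x₀ : EuclideanSpace ℝ (Fin 3)) (t₀ r : ℝ), t₀ ≤ 0 → 0 < r → (∀ t, t₀ - r ^ 2 < t → t < t₀ → r⁻¹ * ∫ x in Metric.ball x₀ r, ‖u t x‖ ^ 2 ≤ C) ∧ r⁻¹ * ∫ t in Set.Ioo (t₀ - r ^ 2) t₀, ∫ x in Metric.ball x₀ r, ‖fderiv ℝ (u t) x‖ ^ 2 ≤ C) → ∀ Λ : ℕ → ℝ, (∀ n, 0 < Λ n ∧ Λ n ≤ 1) → ∃ (φ : ℕ → ℕ) (v : ℝ → EuclideanSpace ℝ (Fin 3) → EuclideanSpace ℝ (Fin 3)), StrictMono φ ∧ (ContDiffOn ℝ (⊤ : ℕ∞) (Function.uncurry v) (Set.Iio 0 ×ˢ Set.univ) ∧ (∀ t < 0, Literature.Analysis.FluidPDE.VectorCalculus.IsDivFree (v t)) ∧ (∀ s t : ℝ, s < t → t < 0 → ∀ x, v t x = Literature.Analysis.FluidPDE.heatFlow (v s) (t - s) x - ∫ τ in Set.Ioo s t, ∫ y, ((-(inner ℝ (x - y) (v τ y) / (2 * (t - τ)) * Literature.Analysis.UnboundedOperators.heatKernel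 (t - τ) (x - y))) • v τ y + (∫ σ in Set.Ioi (t - τ), Literature.Analysis.UnboundedOperators.heatKernel σ (x - y) / (4 * σ ^ 2)) • (inner ℝ (x - y) (v τ y) • v τ y + inner ℝ (v τ y) (v τ y) • (x - y) + inner ℝ (x - y) (v τ y) • v τ y) - ((∫ σ in Set.Ioi (t - τ), Literature.Analysis.UnboundedOperators.heatKernel σ (x - y) / (8 * σ ^ 3)) * (inner ℝ (x - y) (v τ y) * inner ℝ (x - y) (v τ y))) • (x - y))) ∧ Literature.Analysis.FluidPDE.HasTypeITimeDecay C v ∧ (∀ (x₀ : EuclideanSpace ℝ (Fin 3)) (t₀ r : ℝ), t₀ ≤ 0 → 0 < r → (∀ t, t₀ - r ^ 2 < t → t < t₀ → r⁻¹ * ∫ x in Metric.ball x₀ r, ‖v t x‖ ^ 2 ≤ C) ∧ r⁻¹ * ∫ t in Set.Ioo (t₀ - r ^ 2) t₀, ∫ x in Metric.ball x₀ r, ‖fderiv ℝ (v t) x‖ ^ 2 ≤ C)) ∧ ∀ t : ℝ, t < 0 → ∀ (c₀ : ℝ) (b : EuclideanSpace ℝ (Fin 3)) (c : ℕ → ℝ)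 (b' : ℕ → EuclideanSpace ℝ (Fin 3)), Filter.Tendsto c Filter.atTop (nhds c₀) → Filter.Tendsto b' Filter.atTop (nhds b) → Filter.Tendsto (fun k => Real.sqrt (-(Λ (φ k) ^ 2 * t)) * ∫ x, ‖(c k * Real.sqrt (-(Λ (φ k) ^ 2 * t))) • Literature.Analysis.FluidPDE.timeDeriv u (Λ (φ k) ^ 2 * t) x + fderiv ℝ (u (Λ (φ k) ^ 2 * t)) x (b' k)‖ ^ 2 * Real.exp (-(‖x‖ ^ 2) / (4 * (-(Λ (φ k) ^ 2 * t))))) Filter.atTop (nhds (Real.sqrt (-t) * ∫ x, ‖(c₀ * Real.sqrt (-t)) • Literature.Analysis.FluidPDE.timeDeriv v t x + fderiv ℝ (v t) x b‖ ^ 2 * Real.exp (-(‖x‖ ^ 2) / (4 * (-t))))) := by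
  intro hUB C u hu Λ hΛ
  obtain ⟨K, hK⟩ := hUB
  have hTI : IsTypeIAncientMild C u :=
    isTypeIAncientMild_iff.2 ⟨hu.1, hu.2.1, hu.2.2.1, hu.2.2.2.1⟩
  obtain ⟨φ, W, hφ, hW, hpt, -⟩ := exists_zoomLimit hTI fun n => (hΛ n).1
  -- the zoomed subsequence lies in the class, with the same constant
  set w : ℕ → ℝ → EuclideanSpace ℝ (Fin 3) → EuclideanSpace ℝ (Fin 3) :=
    fun j => nsRescale (Λ (φ j)) u with hw_def
  have hwcl := fun j => zoomClass_nsRescale C (Λ (φ j)) u (hΛ (φ j)).1 hu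
  have hw : ∀ j, IsTypeIAncientMild C (w j) := fun j =>
    isTypeIAncientMild_iff.2 ⟨(hwcl j).1, (hwcl j).2.1, (hwcl j).2.2.1, (hwcl j).2.2.2.1⟩
  -- the uniform bounds along the sequence
  have hb := fun j (t : ℝ) (ht : t < 0) (x : EuclideanSpace ℝ (Fin 3)) => hK C (w j) (hwcl j) t ht x
  -- convergence of the modes, of the gradients, and of the local energies
  have htd : ∀ t < 0, ∀ x, Tendsto (fun n => timeDeriv (w n) t x) atTop (𝓝 (timeDeriv W t x)) :=
    fun t ht x => tendsto_timeDeriv_of_typeI hw hW hpt (fun n t ht x => (hb n t ht x).2.2.2.2) ht x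
  have hfd : ∀ t < 0, ∀ x e, Tendsto (fun n => fderiv ℝ (w n t) x e) atTop
      (𝓝 (fderiv ℝ (W t) x e)) :=
    fun t ht x e => tendsto_fderiv_apply_of_typeI hw hW hpt (fun n t ht x => (hb n t ht x).2.2.1) ht x e
  have hgrad : ∀ t < 0, ∀ x, Tendsto (fun n => fderiv ℝ (w n t) x) atTop (𝓝 (fderiv ℝ (W t) x)) :=
    fun t ht x => tendsto_clm_of_tendsto_apply fun e => hfd t ht x e
  have hLEW := localEnergy_of_limit hw hW hpt hgrad (fun n t ht x => (hb n t ht x).2.1)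
    fun n => (hwcl n).2.2.2.2
  have hW' := isTypeIAncientMild_iff.1 hW
  refine ⟨φ, W, hφ, ⟨hW'.1, hW'.2.1, hW'.2.2.1, hW'.2.2.2, hLEW⟩, fun t ht c₀ b c b' hc hb' => ?_⟩
  -- continuous convergence of the frame form, transported to `u` by the zoom covariance
  have key := tendsto_frame_of_limit hw hW htd hfd (fun n t ht x => (hb n t ht x).1)
    (fun n t ht x => (hb n t ht x).2.1) ht c₀ b hc hb'
  refine key.congr fun n => ?_
  have hc2t : Λ (φ n) ^ 2 * t < 0 := mul_neg_of_pos_of_neg (pow_pos (hΛ (φ n)).1 2) ht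
  exact frame_zoom (hΛ (φ n)).1
    (fun y => ((steadySlice_hasDerivAt_curve hTI.contDiffOn y hc2t).1).differentiableAt)
    ((hTI.contDiff_slice hc2t).differentiable (by simp)) (c n) (b' n)


/-- **Stub `stub_zoomCompactness` of crux `ClockCeiling` (line `registered`).** For every element
`u` of the route's Type-I class and every sequence of zoom factors `Λₙ ∈ (0,1]` there are a
subsequence `φ` and an element `v` of the class (same constant) such that the frame form converges
continuously: `frame_u(Λ_{φk}² t; c_k, b_k) → frame_v(t; c₀, b)` whenever `(c_k, b_k) → (c₀, b)`,
`t < 0`. The uniform bounds are supplied by the landed `stub_uniformBounds` (KNSS 2009 Lemma 6.1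
for the zooms + Prop. 4.1 uniform bounds + dominated convergence).
[cite: KochNadirashviliSereginSverak2009, Lemma 6.1 and Prop. 4.1 (arXiv:0709.3599 pp. 8, 11)] -/
theorem stub_zoomCompactness :
    ∀ (C : ℝ) (u : ℝ → EuclideanSpace ℝ (Fin 3) → EuclideanSpace ℝ (Fin 3)), ContDiffOn ℝ (⊤ : ℕ∞) (Function.uncurry u) (Set.Iio 0 ×ˢ Set.univ) ∧ (∀ t < 0, Literature.Analysis.FluidPDE.VectorCalculus.IsDivFree (u t)) ∧ (∀ s t : ℝ, s < t → t < 0 → ∀ x, u t x = Literature.Analysis.FluidPDE.heatFlow (u s) (t - s) x - ∫ τ in Set.Ioo s t, ∫ y, ((-(inner ℝ (x - y) (u τ y) / (2 * (t - τ)) * Literature.Analysis.UnboundedOperators.heatKernel (t - τ) (x - y))) • u τ y + (∫ σ in Set.Ioi (t - τ), Literature.Analysis.UnboundedOperators.heatKernel σ (x - y) / (4 * σ ^ 2)) • (inner ℝ (x - y) (u τ y) • u τ y + inner ℝ (u τ y) (u τ y) • (x - y) + inner ℝ (x - y) (u τ y) • u τ y) - ((∫ σ in Set.Ioi (t - τ),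 Literature.Analysis.UnboundedOperators.heatKernel σ (x - y) / (8 * σ ^ 3)) * (inner ℝ (x - y) (u τ y) * inner ℝ (x - y) (u τ y))) • (x - y))) ∧ Literature.Analysis.FluidPDE.HasTypeITimeDecay C u ∧ (∀ (x₀ : EuclideanSpace ℝ (Fin 3)) (t₀ r : ℝ), t₀ ≤ 0 → 0 < r → (∀ t, t₀ - r ^ 2 < t → t < t₀ → r⁻¹ * ∫ x in Metric.ball x₀ r, ‖u t x‖ ^ 2 ≤ C) ∧ r⁻¹ * ∫ t in Set.Ioo (t₀ - r ^ 2) t₀, ∫ x in Metric.ball x₀ r, ‖fderiv ℝ (u t) x‖ ^ 2 ≤ C) → ∀ Λ : ℕ → ℝ, (∀ n, 0 < Λ n ∧ Λ n ≤ 1) → ∃ (φ : ℕ → ℕ) (v : ℝ → EuclideanSpace ℝ (Fin 3) → EuclideanSpace ℝ (Fin 3)), StrictMono φ ∧ (ContDiffOn ℝ (⊤ : ℕ∞) (Function.uncurry v) (Set.Iio 0 ×ˢ Set.univ) ∧ (∀ t < 0, Literature.Analysis.FluidPDE.VectorCalculus.IsDivFree (v t)) ∧ (∀ s t : ℝ,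 s < t → t < 0 → ∀ x, v t x = Literature.Analysis.FluidPDE.heatFlow (v s) (t - s) x - ∫ τ in Set.Ioo s t, ∫ y, ((-(inner ℝ (x - y) (v τ y) / (2 * (t - τ)) * Literature.Analysis.UnboundedOperators.heatKernel (t - τ) (x - y))) • v τ y + (∫ σ in Set.Ioi (t - τ), Literature.Analysis.UnboundedOperators.heatKernel σ (x - y) / (4 * σ ^ 2)) • (inner ℝ (x - y) (v τ y) • v τ y + inner ℝ (v τ y) (v τ y) • (x - y) + inner ℝ (x - y) (v τ y) • v τ y) - ((∫ σ in Set.Ioi (t - τ), Literature.Analysis.UnboundedOperators.heatKernel σ (x - y) / (8 * σ ^ 3)) * (inner ℝ (x - y) (v τ y) * inner ℝ (x - y) (v τ y))) • (x - y))) ∧ Literature.Analysis.FluidPDE.HasTypeITimeDecay C v ∧ (∀ (x₀ : EuclideanSpace ℝ (Fin 3)) (t₀ r : ℝ), t₀ ≤ 0 → 0 < r → (∀ t, t₀ - r ^ 2 < t → t < t₀ → r⁻¹ * ∫ x in Metric.ball x₀ r, ‖v t x‖ ^ 2 ≤ C) ∧ r⁻¹ * ∫ t in Set.Ioo (t₀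 - r ^ 2) t₀, ∫ x in Metric.ball x₀ r, ‖fderiv ℝ (v t) x‖ ^ 2 ≤ C)) ∧ ∀ t : ℝ, t < 0 → ∀ (c₀ : ℝ) (b : EuclideanSpace ℝ (Fin 3)) (c : ℕ → ℝ) (b' : ℕ → EuclideanSpace ℝ (Fin 3)), Filter.Tendsto c Filter.atTop (nhds c₀) → Filter.Tendsto b' Filter.atTop (nhds b) → Filter.Tendsto (fun k => Real.sqrt (-(Λ (φ k) ^ 2 * t)) * ∫ x, ‖(c k * Real.sqrt (-(Λ (φ k) ^ 2 * t))) • Literature.Analysis.FluidPDE.timeDeriv u (Λ (φ k) ^ 2 * t) x + fderiv ℝ (u (Λ (φ k) ^ 2 * t)) x (b' k)‖ ^ 2 * Real.exp (-(‖x‖ ^ 2) / (4 * (-(Λ (φ k) ^ 2 * t))))) Filter.atTop (nhds (Real.sqrt (-t) * ∫ x, ‖(c₀ * Real.sqrt (-t)) • Literature.Analysis.FluidPDE.timeDeriv v t x + fderiv ℝ (v t) x b‖ ^ 2 * Real.exp (-(‖x‖ ^ 2) / (4 * (-t))))) :=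
  fun C u hu Λ hΛ => zoomCompactness_of_uniformBounds stub_uniformBounds C u hu Λ hΛ

end Summit.NavierStokesRegularity.NavierStokesRegularity.Theorems

end
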